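import Summits.Schanuel.Schanuel.Theorems.DiophantineDichotomyKhovanskiiApproxTypeEvDefs
import Summits.Schanuel.Schanuel.Theorems.DiophantineDichotomyKhovanskiiReduction
import Summits.Schanuel.Schanuel.Theorems.DiophantineDichotomyKhovanskiiApproxTypeEvAnchoredBasis

/-!
# Route `DiophantineDichotomy`, crux `KhovanskiiApproxTypeEv`, line `anchored-reduction`:
# stub `stub_anchoredReduction` — Schanuel on anchored tuples from Schanuel at anchored free
# Khovanskii points

Crux `Summit.Schanuel.Schanuel.Theses.DiophantineDichotomy.KhovanskiiApproxTypeEv`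
(item stmt-Schanuel-14972), line `anchored-reduction`, registered stub `stub_anchoredReduction`
(`--supports`): `KhovanskiiSchanuelAnchored → SchanuelAnchored` (vocabulary of
`Theorems/DiophantineDichotomyKhovanskiiApproxTypeEvDefs.lean`).

## Proof

Verbatim the proof of `Summit.Schanuel.Schanuel.Theorems.card_le_trdeg_of_khovanskiiSchanuel`
(`Theorems/DiophantineDichotomyKhovanskiiReduction.lean`, Kirby 2010 Prop. 7.1/7.2 and p. 11), run
inside the class of ANCHORED tuples `x̄ = (1, iπ, x₂, …, x_{n+1})`: strong induction on `n` inside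
`L = ℚ(x̄, e^{x̄})`, Khovanskii dichotomy
(`Literature.NumberTheory.Transcendental.khovanskii_dichotomy`).  Case (a) (`x̄` a free Khovanskii
point) is the hypothesis.  In case (b) (a non-zero E-derivation `D` of `L/ℚ`) the anchors are
invisible to `D`: `D 1 = 0`, and `D(e^{iπ}) = D(−1) = 0 = e^{iπ} D(iπ)` forces `D(iπ) = 0`;
hence `e₀, e₁` lie in the dependence space `V = {q ∈ ℚⁿ⁺² | q·x̄ ∈ ker D}` and
`stub_anchoredBasis` (`Theorems/DiophantineDichotomyKhovanskiiApproxTypeEvAnchoredBasis.lean`) gives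
an integral basis `w₀ = e₀, w₁ = e₁, w₂, …` of `V`, so the tuple `z̄ = (w_k·x̄)_k = (1, iπ, …)` is
again anchored and the induction hypothesis applies to it; Ax's theorem
(`Literature.NumberTheory.Transcendental.Ax1971.add_rank_le_trdeg`) for a maximal sub-tuple
independent modulo `ker D` and the tower law
(`Literature.NumberTheory.Transcendental.trdeg_add_le_of_le_subring`) conclude as in the template.

## Contents

* `card_le_trdeg_anchored` — the anchored induction.
* `stub_anchoredReduction` — the registered stub, by name.
-/

noncomputable section

-- `Summit.Schanuel.Schanuel.…` is the mandated summit/sub-problem namespace (single-conjunct summit), hence: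
set_option linter.dupNamespace false

open Cardinal MvPolynomial

namespace Summit.Schanuel.Schanuel.Cruxes.KhovanskiiApproxTypeEv.AnchoredReduction

open Literature.NumberTheory.Transcendental

-- one long elementary induction (the template `card_le_trdeg_of_khovanskiiSchanuel` with the
-- anchors threaded through); splitting it would mean threading a dozen `set` abbreviations around
/-- **Schanuel on anchored tuples from Schanuel at anchored free Khovanskii points.** If every
`ℚ`-linearly independent anchored `s = (1, iπ, s₂, …) ∈ ℂⁿ⁺²` which is a non-degenerate solution of
a Khovanskii system over `ℚ` has `trdeg_ℚ ℚ(s, e^s) ≥ n + 2` (`KhovanskiiSchanuelAnchored`), then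
every `ℚ`-linearly independent anchored `x̄ ∈ ℂⁿ⁺²` has `trdeg_ℚ ℚ(x̄, e^{x̄}) ≥ n + 2`.  Strong
induction on `n` inside `L = ℚ(x̄, e^{x̄})` via the Khovanskii dichotomy: either `x̄` is a free
Khovanskii point (hypothesis), or a non-zero E-derivation `D` of `L` kills `1` and `iπ`
(`D(e^{iπ}) = D(−1) = 0`), so the dependence space `{q | q·x̄ ∈ ker D} ∋ e₀, e₁` has an integral
basis starting with `e₀, e₁` (`stub_anchoredBasis`), the sub-tuple `z̄ = (1, iπ, …)` is anchored
(induction), and Ax 1971 Thm. 3 plus the tower law conclude.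
[cite: Kirby2010, Prop. 7.1, Prop. 7.2] -/
theorem card_le_trdeg_anchored (hX : KhovanskiiSchanuelAnchored) :
    ∀ (n : ℕ) (x : Fin (n + 2) → ℂ), x 0 = 1 → x 1 = Complex.I * Real.pi →
      LinearIndependent ℚ x →
      ((n + 2 : ℕ) : Cardinal) ≤ Algebra.trdeg ℚ
        ↥(IntermediateField.adjoin ℚ (Set.range x ∪ Set.range (Complex.exp ∘ x))) := by
  intro n
  induction n using Nat.strong_induction_on with
  | _ n ih =>
  intro x h0 h1 hx
  classical
  -- the field `L = ℚ(x̄, e^{x̄})`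
  set S : Set ℂ := Set.range x ∪ Set.range (Complex.exp ∘ x) with hS
  set L : IntermediateField ℚ ℂ := IntermediateField.adjoin ℚ S with hL
  have hxS : ∀ i, x i ∈ L := fun i => IntermediateField.subset_adjoin ℚ S (Or.inl ⟨i, rfl⟩)
  have hyS : ∀ i, Complex.exp (x i) ∈ L := fun i =>
    IntermediateField.subset_adjoin ℚ S (Or.inr ⟨i, rfl⟩)
  set xL : Fin (n + 2) → L := fun i => ⟨x i, hxS i⟩ with hxL
  set yL : Fin (n + 2) → L := fun i => ⟨Complex.exp (x i), hyS i⟩ with hyL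
  have hy0 : ∀ i, yL i ≠ 0 := fun i h => Complex.exp_ne_zero (x i) (congrArg Subtype.val h)
  have htopL : IntermediateField.adjoin ℚ (Set.range xL ∪ Set.range yL) = ⊤ := by
    have h := IntermediateField.adjoin_preimage_val_eq_top (F := ℚ) S
    have hpre : Set.range xL ∪ Set.range yL = ((↑) : L → ℂ) ⁻¹' S := by
      ext t
      simp only [Set.mem_union, Set.mem_range, Set.mem_preimage, hS, Function.comp_apply]
      constructor
      · rintro (⟨i, rfl⟩ | ⟨i, rfl⟩)
        · exact Or.inl ⟨i, rfl⟩
        · exact Or.inr ⟨i, rfl⟩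
      · rintro (⟨i, hi⟩ | ⟨i, hi⟩)
        · exact Or.inl ⟨i, Subtype.ext hi⟩
        · exact Or.inr ⟨i, Subtype.ext hi⟩
    rw [hpre]
    exact h
  set zL : Fin (n + 2) ⊕ Fin (n + 2) → L := Sum.elim xL yL with hzL
  rcases khovanskii_dichotomy xL yL htopL with ⟨g, hg0, hdet⟩ | ⟨D, hDE, j₀, hj₀⟩
  · /- (a) `x̄` is an (anchored) free Khovanskii point: the hypothesis applies -/
    simp only [← hzL] at hg0 hdet
    have hpt : Sum.elim x (Complex.exp ∘ x) = algebraMap L ℂ ∘ zL := by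
      funext s; rcases s with i | i <;> rfl
    have heval : ∀ p : MvPolynomial (Fin (n + 2) ⊕ Fin (n + 2)) ℚ,
        aeval (Sum.elim x (Complex.exp ∘ x)) p = algebraMap L ℂ (aeval zL p) := by
      intro p
      rw [hpt, aeval_algebraMap_apply]
    refine hX n x h0 h1 hx ⟨g, fun i => ?_, ?_⟩
    · rw [heval, hg0 i, map_zero]
    · have hJ : (Matrix.of fun i j => aeval (Sum.elim x (Complex.exp ∘ x))
          (pderiv (Sum.inl j) (g i) + X (Sum.inr j) * pderiv (Sum.inr j) (g i))) =
          (algebraMap L ℂ).mapMatrix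
            (Matrix.of fun i j => aeval zL (Khovanskii.ePD j (g i))) := by
        ext i j
        simp only [Matrix.of_apply, RingHom.mapMatrix_apply, Matrix.map_apply]
        rw [← heval]
        rfl
      rw [hJ, ← RingHom.map_det, map_ne_zero]
      exact hdet
  · /- (b) a non-zero E-derivation `D` of `L` over `ℚ` -/
    -- `D` as a `ℤ`-derivation, its constants `CD`
    set Dz : Derivation ℤ L L := D.restrictScalars ℤ with hDz
    set D1 : Fin 1 → Derivation ℤ L L := fun _ => Dz with hD1
    set CD : Subring L := constantSubring D1 with hCD
    have hmemCD : ∀ a : L, a ∈ CD ↔ D a = 0 := fun a => by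
      simp only [hCD, hD1, hDz, mem_constantSubring, forall_const]
      exact Iff.rfl
    have hFCD : ∀ c : ℚ, algebraMap ℚ L c ∈ CD := fun c => (hmemCD _).mpr (D.map_algebraMap c)
    -- the elements of `L` killed by `D`, as a `ℚ`-subspace `N` of `ℂ`
    set N : Submodule ℚ ℂ :=
      (LinearMap.ker (D : L →ₗ[ℚ] L)).map (IsScalarTower.toAlgHom ℚ L ℂ).toLinearMap with hN
    have hmemN : ∀ a : ℂ, a ∈ N ↔ ∃ l : L, D l = 0 ∧ (l : ℂ) = a := fun a => by
      simp only [hN, Submodule.mem_map, LinearMap.mem_ker]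
      constructor
      · rintro ⟨l, hl, rfl⟩; exact ⟨l, hl, rfl⟩
      · rintro ⟨l, hl, rfl⟩; exact ⟨l, hl, rfl⟩
    -- the dependence space `V = {q ∈ ℚⁿ⁺² | q·x̄ ∈ N}`; it contains the anchors `e₀, e₁`
    set T : (Fin (n + 2) → ℚ) →ₗ[ℚ] ℂ := Fintype.linearCombination ℚ x with hT
    have hTapply : ∀ v : Fin (n + 2) → ℚ, T v = ∑ i, v i • x i := fun v =>
      Fintype.linearCombination_apply ℚ x v
    set V : Submodule ℚ (Fin (n + 2) → ℚ) := N.comap T with hV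
    have hmemV : ∀ i, (Pi.single i (1 : ℚ) : Fin (n + 2) → ℚ) ∈ V ↔ D (xL i) = 0 := fun i => by
      rw [hV, Submodule.mem_comap, hT, Fintype.linearCombination_apply_single, one_smul, hmemN]
      constructor
      · rintro ⟨l, hl0, hl⟩
        have hlx : l = xL i := Subtype.ext hl
        rw [← hlx]
        exact hl0
      · exact fun h => ⟨xL i, h, rfl⟩
    have he0 : (Pi.single 0 1 : Fin (n + 2) → ℚ) ∈ V := by
      rw [hmemV, show xL 0 = 1 from Subtype.ext h0]
      exact Derivation.map_one_eq_zero D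
    have he1 : (Pi.single 1 1 : Fin (n + 2) → ℚ) ∈ V := by
      rw [hmemV]
      have hy1 : yL 1 = -1 := Subtype.ext (by
        change Complex.exp (x 1) = ((-1 : L) : ℂ)
        push_cast
        rw [h1, mul_comm, Complex.exp_pi_mul_I])
      have h := hDE 1
      rw [hy1, map_neg, Derivation.map_one_eq_zero, neg_zero, neg_one_mul] at h
      exact neg_eq_zero.mp h.symm
    -- the splitting `n + 2 = n' + (m + 2)` and an integral basis of `V` starting with `e₀, e₁`
    set T' : (Fin (n + 2) → ℚ) →ₗ[ℚ] ℂ ⧸ N := N.mkQ ∘ₗ T with hT'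
    have hker : LinearMap.ker T' = V := by rw [hT', LinearMap.ker_comp, Submodule.ker_mkQ]
    obtain ⟨κ, a, ha, hspan, hli⟩ := exists_linearIndependent' ℚ ((Submodule.mkQ N) ∘ x)
    haveI : Fintype κ := Fintype.ofInjective a ha
    set n' := Fintype.card κ with hn'
    set e := Fintype.equivFin κ with he
    have hrange : Module.finrank ℚ (LinearMap.range T') = n' := by
      have h1 : LinearMap.range T' = Submodule.span ℚ (Set.range (N.mkQ ∘ x)) := by
        rw [hT', LinearMap.range_comp, hT, Fintype.range_linearCombination, Submodule.map_span,
          ← Set.range_comp]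
      rw [h1, ← hspan, finrank_span_eq_card hli]
    obtain ⟨m, w, hVm, hw0, hw1, huV, hli_u⟩ := stub_anchoredBasis n V he0 he1
    have hnm : n' + (m + 2) = n + 2 := by
      have := LinearMap.finrank_range_add_finrank_ker T'
      rwa [hrange, hker, hVm, Module.finrank_fin_fun] at this
    have hmn : m < n := by
      by_contra hmn'
      have hVtop : V = ⊤ :=
        Submodule.eq_top_of_finrank_eq (by rw [hVm, Module.finrank_fin_fun]; omega)
      have hmem : (Pi.single j₀ (1 : ℚ) : Fin (n + 2) → ℚ) ∈ V := hVtop ▸ Submodule.mem_top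
      exact hj₀ ((hmemV j₀).mp hmem)
    -- Ax's theorem for a maximal sub-tuple `x̄'` of `x̄` independent modulo `N`
    set x' : Fin n' → L := fun i => xL (a (e.symm i)) with hx'
    set y' : Fin n' → L := fun i => yL (a (e.symm i)) with hy'
    have hind : IsQLinearIndependentMod D1 x' := by
      intro q hq
      have hD0 : D (∑ i, (q i : L) * x' i) = 0 := (hmemCD _).mp hq
      have hNmem : (∑ i, ((q i : ℚ)) • x (a (e.symm i))) ∈ N := by
        refine (hmemN _).mpr ⟨_, hD0, ?_⟩
        rw [show (∑ i, ((q i : ℚ)) • x (a (e.symm i))) = ∑ i, (q i : ℂ) * x (a (e.symm i)) from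
          Finset.sum_congr rfl fun i _ => by rw [Rat.smul_def, Rat.cast_intCast]]
        push_cast
        simp only [hx', hxL]
      have hq0 : ∑ i, ((q i : ℤ) : ℚ) • ((N.mkQ ∘ x ∘ a) ∘ e.symm) i = 0 := by
        have h1 : N.mkQ (∑ i, ((q i : ℚ)) • x (a (e.symm i))) = 0 :=
          (Submodule.Quotient.mk_eq_zero N).mpr hNmem
        rw [map_sum] at h1
        simpa only [map_smul, Function.comp_apply] using h1
      have hli' : LinearIndependent ℚ ((N.mkQ ∘ x ∘ a) ∘ e.symm) :=
        hli.comp e.symm e.symm.injective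
      have h2 := Fintype.linearIndependent_iff.mp hli' _ hq0
      funext i
      exact_mod_cast h2 i
    have hAxL' := Ax1971.add_rank_le_trdeg D1 x' y' (fun i => hy0 _)
      (fun _ i => hDE (a (e.symm i))) hind
    have hAxL := le_trans (Nat.cast_le.mpr (Nat.le_add_right n' _)) hAxL'
    letI algCD : Algebra CD L := Algebra.ofSubsemiring CD
    have hAx : (n' : Cardinal) ≤ Algebra.trdeg CD L :=
      hAxL.trans (trdeg_le_of_injective (Subalgebra.val _) Subtype.val_injective)
    -- the anchored tuple `z̄ = (w_k·x̄)_k = (1, iπ, …)`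
    set z : Fin (m + 2) → ℂ := fun k => ∑ i, (w k i : ℂ) * x i with hz
    have hz0 : z 0 = 1 := by
      rw [← h0]
      simp [hz, hw0, Pi.single_apply]
    have hz1 : z 1 = Complex.I * Real.pi := by
      rw [← h1]
      simp [hz, hw1, Pi.single_apply]
    -- `z̄` is `ℚ`-linearly independent
    have hzind : LinearIndependent ℚ z := by
      rw [Fintype.linearIndependent_iff]
      intro c hc
      have hc1 : ∑ i, (∑ k, c k * (w k i : ℚ)) • x i = 0 := by
        rw [← hc]
        simp only [hz, Finset.smul_sum, Finset.sum_smul, mul_smul]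
        rw [Finset.sum_comm]
        refine Finset.sum_congr rfl fun k _ => Finset.sum_congr rfl fun i _ => ?_
        rw [Rat.smul_def (w k i : ℚ), Rat.cast_intCast]
      have hc2 := Fintype.linearIndependent_iff.mp hx _ hc1
      have hc3 : ∑ k, c k • (fun i => (w k i : ℚ)) = 0 := by
        funext i
        rw [Finset.sum_apply, Pi.zero_apply]
        simpa only [Pi.smul_apply, smul_eq_mul] using hc2 i
      exact Fintype.linearIndependent_iff.mp hli_u c hc3
    -- `z_k ∈ L` and `e^{z_k} ∈ L` are killed by `D`
    set zLk : Fin (m + 2) → L := fun k => ∑ i, (w k i : L) * xL i with hzLk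
    have hzcoe : ∀ k, ((zLk k : L) : ℂ) = z k := fun k => by
      simp only [hzLk, hz, hxL]
      push_cast
      rfl
    have hDz0 : ∀ k, D (zLk k) = 0 := fun k => by
      obtain ⟨l, hl0, hl⟩ := (hmemN _).mp (Submodule.mem_comap.mp (huV k))
      have hTz : T (fun i => (w k i : ℚ)) = z k := by
        rw [hTapply, hz]
        exact Finset.sum_congr rfl fun i _ => by rw [Rat.smul_def, Rat.cast_intCast]
      have hl' : l = zLk k := Subtype.ext (by rw [hl, hTz, hzcoe])
      rw [← hl']
      exact hl0
    set ezLk : Fin (m + 2) → L := fun k => ∏ i, yL i ^ w k i with hezLk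
    have hezcoe : ∀ k, ((ezLk k : L) : ℂ) = Complex.exp (z k) := fun k => by
      rw [hz]
      dsimp only
      rw [Complex.exp_sum]
      simp only [Complex.exp_int_mul, hezLk, hyL]
      push_cast
      rfl
    have hDez0 : ∀ k, D (ezLk k) = 0 := fun k => by
      simp only [hezLk]
      rw [derivation_prod_zpow_of_exp D xL yL hy0 hDE (w k)]
      have : D (∑ i, (w k i : L) * xL i) = 0 := hDz0 k
      rw [this, mul_zero]
    -- induction hypothesis for the anchored tuple `z̄`
    have hIH : ((m + 2 : ℕ) : Cardinal) ≤ Algebra.trdeg ℚ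
        ↥(IntermediateField.adjoin ℚ (Set.range z ∪ Set.range (Complex.exp ∘ z))) :=
      ih m hmn z hz0 hz1 hzind
    set Sz : Set ℂ := Set.range z ∪ Set.range (Complex.exp ∘ z) with hSz
    set Nz : IntermediateField ℚ ℂ := IntermediateField.adjoin ℚ Sz with hNz
    change ((m + 2 : ℕ) : Cardinal) ≤ Algebra.trdeg ℚ Nz at hIH
    have hle : Nz ≤ L := by
      rw [hNz, IntermediateField.adjoin_le_iff]
      rintro t (⟨k, rfl⟩ | ⟨k, rfl⟩)
      · rw [← hzcoe]; exact (zLk k).2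
      · simp only [Function.comp_apply]; rw [← hezcoe]; exact (ezLk k).2
    have hιE : ∀ (t : ℂ) (ht : t ∈ Nz), (⟨t, hle ht⟩ : L) ∈ CD := by
      intro t ht
      rw [hmemCD]
      induction ht using IntermediateField.adjoin_induction with
      | mem t ht =>
        rcases ht with ⟨k, rfl⟩ | ⟨k, rfl⟩
        · have h' : (⟨z k, hle (IntermediateField.subset_adjoin ℚ Sz (Or.inl ⟨k, rfl⟩))⟩ : L) =
              zLk k := Subtype.ext (hzcoe k).symm
          rw [h']; exact hDz0 k
        · have h' : (⟨(Complex.exp ∘ z) k,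
              hle (IntermediateField.subset_adjoin ℚ Sz (Or.inr ⟨k, rfl⟩))⟩ : L) = ezLk k :=
            Subtype.ext (hezcoe k).symm
          rw [h']; exact hDez0 k
      | algebraMap c => exact D.map_algebraMap c
      | add s t hs ht ihs iht =>
        have h' : (⟨s + t, hle (add_mem hs ht)⟩ : L) = ⟨s, hle hs⟩ + ⟨t, hle ht⟩ := rfl
        rw [h', map_add, ihs, iht, add_zero]
      | inv s hs ihs =>
        have h' : (⟨s⁻¹, hle (inv_mem hs)⟩ : L) = (⟨s, hle hs⟩)⁻¹ := rfl
        rw [h', Derivation.leibniz_inv, ihs, smul_zero]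
      | mul s t hs ht ihs iht =>
        have h' : (⟨s * t, hle (mul_mem hs ht)⟩ : L) = ⟨s, hle hs⟩ * ⟨t, hle ht⟩ := rfl
        rw [h', Derivation.leibniz, ihs, iht, smul_zero, smul_zero, add_zero]
    -- assembling: `n + 2 = (m + 2) + n' ≤ trdeg_ℚ Nz + trdeg_CD L ≤ trdeg_ℚ L`
    have htower := trdeg_add_le_of_le_subring L Nz hle CD hFCD hιE
    calc ((n + 2 : ℕ) : Cardinal) = ((m + 2 : ℕ) : Cardinal) + (n' : Cardinal) := by
          rw [← Nat.cast_add]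
          exact congrArg _ (by omega)
      _ ≤ Algebra.trdeg ℚ Nz + Algebra.trdeg CD L := add_le_add hIH hAx
      _ ≤ Algebra.trdeg ℚ L := htower

/-- **Stub `stub_anchoredReduction` as registered**: Schanuel at anchored free Khovanskii points
gives Schanuel on anchored tuples, `KhovanskiiSchanuelAnchored → SchanuelAnchored` — both sides
unfold to the quantifier block of `card_le_trdeg_anchored`. [cite: Kirby2010, Prop. 7.2] -/
theorem stub_anchoredReduction : KhovanskiiSchanuelAnchored → SchanuelAnchored :=
  fun hX n x h0 h1 hx => card_le_trdeg_anchored hX n x h0 h1 hx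

end Summit.Schanuel.Schanuel.Cruxes.KhovanskiiApproxTypeEv.AnchoredReduction

end
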